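import Summits.BirchSwinnertonDyer.Rank1Residual.F1Sign2.ParitySymbolCocycleAtTwoProofsMarkedPoint

/-!
# Cell `bsd-f1-sign2`, lens `-desc` g14 (MEMO-desc §22.13-add2): PROOFS for `ParitySymbolCocycleAtTwo.lean`, part 4 — CASSELS' HALVING LEMMA for the
# marked point over `AdjoinRoot` and row DESC-§22-V PROVED (`thetaDiscrepancySquareIffMarkedPointHalvesAtTwo_holds`: `u ∈ L_E^{×2} ⟺ (0,c) ∈ 2E′_f(ℚ)`)

Contents (ns `…F1Sign2.MarkedPoint`): `coords_eq_zero`, `exists_coords` (coordinates `α₀ + α₁θ′ + α₂θ′²` in `L_{E′} = ℚ[X]/(c_{E′})`),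
`exists_halves_of_isSquare_neg_root` (`−θ′ = (α₀ + α₁θ′ + α₂θ′²)² ⇒ α₂ ≠ 0` and `Q := (α₁/(4α₂) − b, −1/(8α₂))` has `Q + Q = (0,c)`),
`psi_surjective`, `four_mul_thetaDiscrepancy`, `isSquare_neg_root_of_isSquare_thetaDiscrepancy`, `MarkedPoint.thetaDiscrepancySquareIffMarkedPointHalvesAtTwo_holds`;
then `Summit.BirchSwinnertonDyer.Rank1Residual.F1Sign2.thetaDiscrepancySquareIffMarkedPointHalvesAtTwo_holds` (row V BY NAME).  Imports part 3 (the `⇐` half and the torsion lemmas).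

TYPER FILING (seat `bsd-f1-sign2-ty` g8): source `HOME/MEMO-desc-data/g14/lean/MarkedPoint.lean` 39fea69b4f1f29aa (462 l.; planner -desc g14, ADDENDUM 6
2026-08-28T09:49:51Z; farm rc 0 · 0 warn · 0 sorry, axioms propext, Classical.choice, Quot.sound; REF1 D-desc-ref1-23 scope = cmpdecls/axioms on this file),
proofs VERBATIM, split in two only for the 400-line cap on `F1Sign2` modules carrying proofs (part 3 = lines 69–200 + 438–460, part 4 = lines 202–436).
The planner's local copies of the row defs V/V′ and of `gmPartner_nonsingular_markedPoint` are DELETED: the rows and that support lemma live in the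
statement module `F1Sign2/ParitySymbolCocycleAtTwo.lean` §B-add (-ty V-append p623106), so the theorems prove the TREE rows by name (same discipline as
parts 1–2, p620606/p621018: helpers in the planner's sub-namespace `…F1Sign2.MarkedPoint`, `…F1Sign2.<row>_holds` at the end).  Builder
`tools/mk_desc22proofs_mp.py` (sha-asserting; published with the filed text under `HOME/MEMO-ty-data/g8/`); no `sorry`, no new `def … : Prop`, no `instance`,
no `notation`; docstrings as in the planner's file.  REF1 §89 (b): rows V/V′ CLEARED (V theorem on paper via Cassels LMSST §15 Lemma 2 or REF1's explicit
tangent route; V′ = V + `E′(ℚ)[2] = 0`); REF2 v22 §2: VARIANT / in-print assembly (Bruin 2004 §5 + Cassels 1991 §15 Lemma 2; V′ adds Bruin Cor. 3.4).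
-/

noncomputable section

open scoped Classical

open WeierstrassCurve Polynomial

namespace Summit.BirchSwinnertonDyer.Rank1Residual.F1Sign2.MarkedPoint

/-! ## The converse (Cassels' halving lemma over `AdjoinRoot`): `u ∈ L_E^{×2} ⇒ (0,c) ∈ 2E′_f(ℚ)` -/

/-- Uniqueness of coordinates w.r.t. `1, θ′, θ′²` in the cubic algebra `L_{E′} = ℚ[X]/(c_{E′})`. -/
lemma coords_eq_zero (a b c : ℤ) (r₀ r₁ r₂ : ℚ)
    (h : algebraMap ℚ (twoDivisionAlgebra (gmPartner a b c)) r₀ + algebraMap ℚ (twoDivisionAlgebra (gmPartner a b c)) r₁ * twoDivisionRoot (gmPartner a b c) +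
        algebraMap ℚ (twoDivisionAlgebra (gmPartner a b c)) r₂ * twoDivisionRoot (gmPartner a b c) ^ 2 = 0) :
    r₀ = 0 ∧ r₁ = 0 ∧ r₂ = 0 := by
  have hmk : AdjoinRoot.mk (twoDivisionUCubic (gmPartner a b c)) (C r₂ * X ^ 2 + C r₁ * X + C r₀) = 0 := by
    rw [← AdjoinRoot.aeval_eq]
    simp only [map_add, map_mul, map_pow, aeval_C, aeval_X]
    linear_combination h
  rw [AdjoinRoot.mk_eq_zero] at hmk
  have hP0 : (C r₂ * X ^ 2 + C r₁ * X + C r₀ : ℚ[X]) = 0 := by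
    by_contra hne
    have h1 := Polynomial.natDegree_le_of_dvd hmk hne
    have h2 : (C r₂ * X ^ 2 + C r₁ * X + C r₀ : ℚ[X]).natDegree ≤ 2 := Polynomial.natDegree_quadratic_le
    rw [twoDivisionUCubic_natDegree] at h1
    omega
  have e0 : r₀ = 0 := by simpa using congrArg (Polynomial.coeff · 0) hP0
  have e1 : r₁ = 0 := by simpa using congrArg (Polynomial.coeff · 1) hP0
  have e2 : r₂ = 0 := by simpa using congrArg (Polynomial.coeff · 2) hP0
  exact ⟨e0, e1, e2⟩

/-- Every element of `L_{E′}` has coordinates `α₀ + α₁θ′ + α₂θ′²`. -/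
lemma exists_coords (a b c : ℤ) (v : (twoDivisionAlgebra (gmPartner a b c))) :
    ∃ α₀ α₁ α₂ : ℚ, v = algebraMap ℚ (twoDivisionAlgebra (gmPartner a b c)) α₀ + algebraMap ℚ (twoDivisionAlgebra (gmPartner a b c)) α₁ * twoDivisionRoot (gmPartner a b c) +
      algebraMap ℚ (twoDivisionAlgebra (gmPartner a b c)) α₂ * twoDivisionRoot (gmPartner a b c) ^ 2 := by
  obtain ⟨p, hp⟩ := AdjoinRoot.mk_surjective v
  have hmonic := twoDivisionUCubic_monic (gmPartner a b c)
  have hpq : AdjoinRoot.mk (twoDivisionUCubic (gmPartner a b c)) p =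
      AdjoinRoot.mk (twoDivisionUCubic (gmPartner a b c)) (p %ₘ twoDivisionUCubic (gmPartner a b c)) := by
    rw [AdjoinRoot.mk_eq_mk, Polynomial.modByMonic_eq_sub_mul_div p (twoDivisionUCubic (gmPartner a b c))]
    exact ⟨p /ₘ twoDivisionUCubic (gmPartner a b c), by ring⟩
  have hne1 : twoDivisionUCubic (gmPartner a b c) ≠ 1 := by
    intro h1
    have := congrArg Polynomial.natDegree h1
    rw [twoDivisionUCubic_natDegree] at this
    simp at this
  have hdeg : (p %ₘ twoDivisionUCubic (gmPartner a b c)).natDegree ≤ 2 := by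
    have := Polynomial.natDegree_modByMonic_lt p hmonic hne1
    rw [twoDivisionUCubic_natDegree] at this
    omega
  obtain ⟨c₀, c₁, c₂, hqexp⟩ : ∃ c₀ c₁ c₂ : ℚ, p %ₘ twoDivisionUCubic (gmPartner a b c) = C c₀ + C c₁ * X + C c₂ * X ^ 2 := by
    refine ⟨(p %ₘ twoDivisionUCubic (gmPartner a b c)).coeff 0, (p %ₘ twoDivisionUCubic (gmPartner a b c)).coeff 1,
      (p %ₘ twoDivisionUCubic (gmPartner a b c)).coeff 2, ?_⟩
    ext n
    rcases n with _ | _ | _ | n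
    · simp
    · simp
    · simp
    · rw [Polynomial.coeff_eq_zero_of_natDegree_lt (by omega)]
      simp
  refine ⟨c₀, c₁, c₂, ?_⟩
  rw [← hp, hpq, hqexp, ← AdjoinRoot.aeval_eq]
  simp only [map_add, map_mul, map_pow, aeval_C, aeval_X]

/-- **Cassels' halving lemma for the marked point** (`⇒` of Thm 4(ii)): if `−θ′` is a square in `L_{E′}` then `(0,c) ∈ 2E′_f(ℚ)`.
The half is `Q = (α₁/(4α₂) − b, −1/(8α₂))` for `−θ′ = (α₀ + α₁θ′ + α₂θ′²)²`. -/
theorem exists_halves_of_isSquare_neg_root (a b c : ℤ)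
    (h : (gmPartner a b c).toAffine.Nonsingular 0 (c : ℚ))
    (hsq : IsSquare (-(twoDivisionRoot (gmPartner a b c)))) :
    ∃ Q : (gmPartner a b c).toAffine.Point, Q + Q = WeierstrassCurve.Affine.Point.some 0 (c : ℚ) h := by
  obtain ⟨v, hv⟩ := hsq
  obtain ⟨α₀, α₁, α₂, hvexp⟩ := exists_coords a b c v
  have hF := GluedPairIdentity.root_relation (gmPartner a b c)
  rw [gmP_b₂, gmP_b₄, gmP_b₆] at hF
  simp only [map_mul, map_ofNat, map_pow] at hF
  -- (1) α₂ ≠ 0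
  have hα₂ : α₂ ≠ 0 := by
    intro h0
    have hA2 : algebraMap ℚ (twoDivisionAlgebra (gmPartner a b c)) α₂ = 0 := by rw [h0, map_zero]
    have key : algebraMap ℚ (twoDivisionAlgebra (gmPartner a b c)) (α₀ ^ 2) + algebraMap ℚ (twoDivisionAlgebra (gmPartner a b c)) (2 * α₀ * α₁ + 1) * twoDivisionRoot (gmPartner a b c) +
        algebraMap ℚ (twoDivisionAlgebra (gmPartner a b c)) (α₁ ^ 2) * twoDivisionRoot (gmPartner a b c) ^ 2 = 0 := by
      simp only [map_add, map_mul, map_pow, map_one, map_ofNat]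
      generalize twoDivisionRoot (gmPartner a b c) = t at hv hvexp ⊢
      generalize algebraMap ℚ (twoDivisionAlgebra (gmPartner a b c)) α₀ = A0 at hvexp ⊢
      generalize algebraMap ℚ (twoDivisionAlgebra (gmPartner a b c)) α₁ = A1 at hvexp ⊢
      generalize algebraMap ℚ (twoDivisionAlgebra (gmPartner a b c)) α₂ = A2 at hvexp hA2 ⊢
      linear_combination (-1 : (twoDivisionAlgebra (gmPartner a b c))) * hv + (-(v + (A0 + A1 * t + A2 * t ^ 2))) * hvexp +
        (-(t ^ 2 * (2 * A0 + 2 * A1 * t + A2 * t ^ 2))) * hA2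
    obtain ⟨-, h1, h2⟩ := coords_eq_zero a b c _ _ _ key
    have : α₁ = 0 := pow_eq_zero_iff (two_ne_zero) |>.mp h2
    rw [this] at h1
    norm_num at h1
  -- (2) the half `Q = (x₀, y₀)` and the defect `r`
  obtain ⟨y₀, hy⟩ : ∃ y₀ : ℚ, 8 * α₂ * y₀ = -1 :=
    ⟨-(8 * α₂)⁻¹, by rw [mul_neg, mul_inv_cancel₀ (mul_ne_zero (by norm_num) hα₂)]⟩
  have hy0 : y₀ ≠ 0 := by rintro rfl; norm_num at hy
  obtain ⟨x₀, hx⟩ : ∃ x₀ : ℚ, 4 * α₂ * (x₀ + b) = α₁ :=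
    ⟨α₁ / (4 * α₂) - b, by rw [sub_add_cancel, mul_div_cancel₀ _ (mul_ne_zero (by norm_num) hα₂)]⟩
  obtain ⟨r, hr⟩ : ∃ r : ℚ, r * y₀ = x₀ ^ 2 - a * c - α₀ * y₀ :=
    ⟨(x₀ ^ 2 - a * c - α₀ * y₀) / y₀, div_mul_cancel₀ _ hy0⟩
  have hy' := congrArg (algebraMap ℚ (twoDivisionAlgebra (gmPartner a b c))) hy
  have hx' := congrArg (algebraMap ℚ (twoDivisionAlgebra (gmPartner a b c))) hx
  have hr' := congrArg (algebraMap ℚ (twoDivisionAlgebra (gmPartner a b c))) hr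
  simp only [map_mul, map_ofNat, map_neg, map_one, map_add, map_sub, map_pow] at hy' hx' hr'
  -- (3) the coefficient equation in L′ : 256 y₀² (−θ′ + 2 r v + r²) = 256 P₃² − 256 g(x₀)(4b + 8x₀) − 256 g(x₀) θ′
  have hK : algebraMap ℚ (twoDivisionAlgebra (gmPartner a b c)) (256 * y₀ ^ 2 * r ^ 2 + 512 * y₀ ^ 2 * r * α₀ - 256 * (3 * x₀ ^ 2 + 2 * b * x₀ + a * c) ^ 2 +
        256 * (x₀ ^ 3 + b * x₀ ^ 2 + a * c * x₀ + (c : ℚ) ^ 2) * (4 * b + 8 * x₀)) +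
      algebraMap ℚ (twoDivisionAlgebra (gmPartner a b c)) (-256 * y₀ ^ 2 + 512 * y₀ ^ 2 * r * α₁ + 256 * (x₀ ^ 3 + b * x₀ ^ 2 + a * c * x₀ + (c : ℚ) ^ 2)) *
        twoDivisionRoot (gmPartner a b c) +
      algebraMap ℚ (twoDivisionAlgebra (gmPartner a b c)) (512 * y₀ ^ 2 * r * α₂) * twoDivisionRoot (gmPartner a b c) ^ 2 = 0 := by
    simp only [map_mul, map_ofNat, map_neg, map_add, map_sub, map_pow]
    generalize twoDivisionRoot (gmPartner a b c) = t at hF hv hvexp ⊢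
    generalize algebraMap ℚ (twoDivisionAlgebra (gmPartner a b c)) x₀ = X0 at hx' hr' ⊢
    generalize algebraMap ℚ (twoDivisionAlgebra (gmPartner a b c)) y₀ = Y0 at hy' hr' ⊢
    generalize algebraMap ℚ (twoDivisionAlgebra (gmPartner a b c)) r = Rr at hr' ⊢
    generalize algebraMap ℚ (twoDivisionAlgebra (gmPartner a b c)) α₀ = A0 at hvexp hr' ⊢
    generalize algebraMap ℚ (twoDivisionAlgebra (gmPartner a b c)) α₁ = A1 at hvexp hx' ⊢
    generalize algebraMap ℚ (twoDivisionAlgebra (gmPartner a b c)) α₂ = A2 at hvexp hy' hx' ⊢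
    generalize algebraMap ℚ (twoDivisionAlgebra (gmPartner a b c)) (a : ℚ) = A at hF hr' ⊢
    generalize algebraMap ℚ (twoDivisionAlgebra (gmPartner a b c)) (b : ℚ) = B at hF hx' ⊢
    generalize algebraMap ℚ (twoDivisionAlgebra (gmPartner a b c)) (c : ℚ) = Cc at hF hr' ⊢
    -- M(x₀) = 16 y₀ (v + r)
    have hMi : (4 * X0 - t) ^ 2 - (3 * t ^ 2 + 8 * B * t + 16 * (A * Cc)) = 16 * Y0 * (v + Rr) := by
      linear_combination (-(16 * Y0)) * hvexp + (-(2 * t ^ 2) - 8 * (X0 + B) * t) * hy' + (16 * Y0 * t) * hx' +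
        (-16 : (twoDivisionAlgebra (gmPartner a b c))) * hr'
    linear_combination (256 * Y0 ^ 2) * hv + (-(512 * Y0 ^ 2 * Rr)) * hvexp +
      (-(16 * Y0 * (v + Rr) + ((4 * X0 - t) ^ 2 - (3 * t ^ 2 + 8 * B * t + 16 * (A * Cc))))) * hMi +
      (4 * (t + 8 * X0 + 4 * B)) * hF
  obtain ⟨hk0, hk1, hk2⟩ := coords_eq_zero a b c _ _ _ hK
  -- (4) read off: r = 0, the curve equation, x(2Q) = 0
  have hr0 : r = 0 := by
    by_contra hne
    exact (mul_ne_zero (mul_ne_zero (mul_ne_zero (by norm_num) (pow_ne_zero 2 hy0)) hne) hα₂) hk2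
  rw [hr0] at hk0 hk1
  have heq : y₀ ^ 2 = x₀ ^ 3 + b * x₀ ^ 2 + a * c * x₀ + (c : ℚ) ^ 2 := by
    linear_combination (-1 / 256 : ℚ) * hk1
  have hdup : (3 * x₀ ^ 2 + 2 * b * x₀ + a * c) ^ 2 = 4 * y₀ ^ 2 * ((b : ℚ) + 2 * x₀) := by
    linear_combination (-1 / 256 : ℚ) * hk0 + (-(4 * b + 8 * x₀)) * heq
  -- (5) the point Q = (x₀, y₀)
  have hQns : (gmPartner a b c).toAffine.Nonsingular x₀ y₀ := by
    rw [WeierstrassCurve.Affine.nonsingular_iff']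
    refine ⟨?_, Or.inr ?_⟩
    · rw [WeierstrassCurve.Affine.equation_iff']
      simp [gmPartner]
      linear_combination heq
    · simp [gmPartner]
      intro h0; apply hy0; linarith
  have hyne : y₀ ≠ (gmPartner a b c).toAffine.negY x₀ y₀ := by
    rw [negY_gmPartner]; intro h0; apply hy0; linarith
  -- Q + Q = (0, ±c)
  obtain ⟨X2, Y2, H2, hQQ, hX2⟩ : ∃ (X2 Y2 : ℚ) (H2 : (gmPartner a b c).toAffine.Nonsingular X2 Y2),
      WeierstrassCurve.Affine.Point.some x₀ y₀ hQns + WeierstrassCurve.Affine.Point.some x₀ y₀ hQns =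
        WeierstrassCurve.Affine.Point.some X2 Y2 H2 ∧ X2 = 0 := by
    refine ⟨_, _, _, WeierstrassCurve.Affine.Point.add_self_of_Y_ne hyne, ?_⟩
    rw [WeierstrassCurve.Affine.slope_of_Y_ne rfl hyne]
    simp only [negY_gmPartner, WeierstrassCurve.Affine.addX]
    simp [gmPartner]
    have h2y : (y₀ - -y₀) ≠ 0 := by intro h0; apply hy0; linarith
    field_simp
    linear_combination hdup
  have hY2 : Y2 ^ 2 = (c : ℚ) ^ 2 := by
    have := equation_gmPartner a b c H2.1
    rw [hX2] at this
    linear_combination this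
  have key : ∀ {x y : ℚ} {hxy : (gmPartner a b c).toAffine.Nonsingular x y}, x = 0 → y = (c : ℚ) →
      WeierstrassCurve.Affine.Point.some x y hxy = WeierstrassCurve.Affine.Point.some 0 (c : ℚ) h := by
    rintro x y hxy rfl rfl; rfl
  rcases sq_eq_sq_iff_eq_or_eq_neg.mp hY2 with hc1 | hc2
  · exact ⟨WeierstrassCurve.Affine.Point.some x₀ y₀ hQns, hQQ.trans (key hX2 hc1)⟩
  · refine ⟨-WeierstrassCurve.Affine.Point.some x₀ y₀ hQns, ?_⟩
    rw [← neg_add, hQQ, WeierstrassCurve.Affine.Point.neg_some]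
    apply key hX2
    rw [negY_gmPartner, hc2, neg_neg]

/-- `ψ` is onto (an injective `ℚ`-algebra map between cubic fields). -/
lemma psi_surjective (a b c : ℤ) [Fact (Irreducible (twoDivisionUCubic (gmCurve a b c)))]
    [Fact (Irreducible (twoDivisionUCubic (gmPartner a b c)))]
    (ψ : (twoDivisionAlgebra (gmPartner a b c)) →ₐ[ℚ] (twoDivisionAlgebra (gmCurve a b c))) : Function.Surjective ψ := by
  haveI := finiteDimensional_twoDivisionAlgebra (gmCurve a b c)
  haveI := finiteDimensional_twoDivisionAlgebra (gmPartner a b c)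
  have hinj : Function.Injective ψ.toLinearMap := fun x y hxy => ψ.toRingHom.injective (by simpa using hxy)
  have hdim : Module.finrank ℚ (twoDivisionAlgebra (gmPartner a b c)) = Module.finrank ℚ (twoDivisionAlgebra (gmCurve a b c)) := by
    rw [finrank_twoDivisionAlgebra, finrank_twoDivisionAlgebra]
  have hsurj := (LinearMap.injective_iff_surjective_of_finrank_eq_finrank hdim).mp hinj
  intro y; obtain ⟨x, hx⟩ := hsurj y; exact ⟨x, by simpa using hx⟩

/-- Row U rescaled: `4·u = −c_E′(θ_E)²·ψ(θ′)` (no field structure needed). -/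
theorem four_mul_thetaDiscrepancy (a b c : ℤ) (hc : c ≠ 0)
    (ψ : (twoDivisionAlgebra (gmPartner a b c)) →ₐ[ℚ] (twoDivisionAlgebra (gmCurve a b c)))
    (hpin : ψ (twoDivisionRoot (gmPartner a b c)) * twoDivisionRoot (gmCurve a b c) = algebraMap ℚ (twoDivisionAlgebra (gmCurve a b c)) (16 * c : ℚ)) :
    4 * thetaDiscrepancyAtTwo (gmCurve a b c) (gmPartner a b c) ψ =
      -(twoDivisionDifferent (gmCurve a b c) ^ 2 * ψ (twoDivisionRoot (gmPartner a b c))) := by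
  have hcQ : (c : ℚ) ≠ 0 := Int.cast_ne_zero.mpr hc
  have hU := GluedPairIdentity.thetaDiscrepancyOfGluedPairAtTwo_holds a b c hc ψ hpin
  have hC0 := congrArg (algebraMap ℚ (twoDivisionAlgebra (gmCurve a b c))) (mul_inv_cancel₀ hcQ)
  have hH0 := congrArg (algebraMap ℚ (twoDivisionAlgebra (gmCurve a b c))) (mul_inv_cancel₀ (two_ne_zero : (2 : ℚ) ≠ 0))
  simp only [map_mul, map_ofNat, map_neg, map_one] at hU hpin hC0 hH0
  generalize thetaDiscrepancyAtTwo (gmCurve a b c) (gmPartner a b c) ψ = u at hU ⊢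
  generalize twoDivisionDifferent (gmCurve a b c) = d at hU ⊢
  generalize twoDivisionRoot (gmCurve a b c) = θ at hU hpin
  generalize ψ (twoDivisionRoot (gmPartner a b c)) = T at hpin ⊢
  generalize algebraMap ℚ (twoDivisionAlgebra (gmCurve a b c)) (c : ℚ)⁻¹ = Ci at hC0
  generalize algebraMap ℚ (twoDivisionAlgebra (gmCurve a b c)) (2 : ℚ)⁻¹ = Hh at hH0
  generalize algebraMap ℚ (twoDivisionAlgebra (gmCurve a b c)) (c : ℚ) = Cc at hU hpin hC0
  have hθ : θ * (T * Ci * Hh ^ 4) = 1 := by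
    linear_combination (Ci * Hh ^ 4) * hpin + (16 * Hh ^ 4) * hC0 + (1 + 2 * Hh + 4 * Hh ^ 2 + 8 * Hh ^ 3) * hH0
  have hu : u = -(4 * d ^ 2 * T * Hh ^ 4) := by
    linear_combination (-(Ci ^ 2 * T * Hh ^ 4)) * hU + (-u) * hθ +
      (-(u * θ * T * Ci * Hh ^ 4 + 4 * d ^ 2 * T * Hh ^ 4 * (Cc * Ci + 1))) * hC0
  linear_combination 4 * hu + (-(d ^ 2 * T) * (1 + 2 * Hh) * (1 + 4 * Hh ^ 2)) * hH0

/-- `u ∈ L_E^{×2} ⇒ −θ′ ∈ L_{E′}^{×2}` (`4u = −c_E′(θ_E)²·ψ(θ′)`, `c_E′(θ_E) ≠ 0` in the field `L_E`, `ψ` bijective). -/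
theorem isSquare_neg_root_of_isSquare_thetaDiscrepancy (a b c : ℤ) (hc : c ≠ 0)
    [Fact (Irreducible (twoDivisionUCubic (gmCurve a b c)))] [Fact (Irreducible (twoDivisionUCubic (gmPartner a b c)))]
    (ψ : (twoDivisionAlgebra (gmPartner a b c)) →ₐ[ℚ] (twoDivisionAlgebra (gmCurve a b c)))
    (hpin : ψ (twoDivisionRoot (gmPartner a b c)) * twoDivisionRoot (gmCurve a b c) = algebraMap ℚ (twoDivisionAlgebra (gmCurve a b c)) (16 * c : ℚ))
    (hsq : IsSquare (thetaDiscrepancyAtTwo (gmCurve a b c) (gmPartner a b c) ψ)) :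
    IsSquare (-(twoDivisionRoot (gmPartner a b c))) := by
  obtain ⟨w, hw⟩ := hsq
  have hA := four_mul_thetaDiscrepancy a b c hc ψ hpin
  have hd : twoDivisionDifferent (gmCurve a b c) ≠ 0 := twoDivisionDifferent_ne_zero (gmCurve a b c)
  have hD := mul_inv_cancel₀ hd
  -- −ψ(θ′) = (2 w / c_E′(θ_E))²
  have hT : -(ψ (twoDivisionRoot (gmPartner a b c))) =
      (2 * w * (twoDivisionDifferent (gmCurve a b c))⁻¹) * (2 * w * (twoDivisionDifferent (gmCurve a b c))⁻¹) := by
    generalize thetaDiscrepancyAtTwo (gmCurve a b c) (gmPartner a b c) ψ = u at hA hw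
    generalize twoDivisionDifferent (gmCurve a b c) = d at hA hD ⊢
    generalize (d)⁻¹ = Di at hD ⊢
    generalize ψ (twoDivisionRoot (gmPartner a b c)) = T at hA ⊢
    linear_combination (-(Di ^ 2)) * hA + (4 * Di ^ 2) * hw + (T * (d * Di + 1)) * hD
  obtain ⟨s, hs⟩ := psi_surjective a b c ψ (2 * w * (twoDivisionDifferent (gmCurve a b c))⁻¹)
  refine ⟨s, ψ.toRingHom.injective ?_⟩
  simp only [AlgHom.toRingHom_eq_coe, RingHom.coe_coe, map_neg, map_mul, hs]
  exact hT

/-- **Row DESC-§22-V PROVED**: `u ∈ L_E^{×2} ⟺ (0,c) ∈ 2E′_f(ℚ)`. -/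
theorem thetaDiscrepancySquareIffMarkedPointHalvesAtTwo_holds : ThetaDiscrepancySquareIffMarkedPointHalvesAtTwo := by
  intro a b c hc _hΔ _ _ ψ hpin h
  constructor
  · intro hsq
    exact exists_halves_of_isSquare_neg_root a b c h (isSquare_neg_root_of_isSquare_thetaDiscrepancy a b c hc ψ hpin hsq)
  · rintro ⟨Q, hQ⟩
    exact isSquare_thetaDiscrepancy_of_halves a b c hc ψ hpin h Q hQ

end Summit.BirchSwinnertonDyer.Rank1Residual.F1Sign2.MarkedPoint

namespace Summit.BirchSwinnertonDyer.Rank1Residual.F1Sign2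

/-- **DESC-§22-V `ThetaDiscrepancySquareIffMarkedPointHalvesAtTwo` HOLDS** (tree row of `ParitySymbolCocycleAtTwo.lean` §B-add, closed by name; proof -desc
g14, Cassels halving over `AdjoinRoot`): `u_{E_f,E′_f} ∈ L_E^{×2} ⟺ (0,c) ∈ 2E′_f(ℚ)`. -/
theorem thetaDiscrepancySquareIffMarkedPointHalvesAtTwo_holds : ThetaDiscrepancySquareIffMarkedPointHalvesAtTwo :=
  MarkedPoint.thetaDiscrepancySquareIffMarkedPointHalvesAtTwo_holds

end Summit.BirchSwinnertonDyer.Rank1Residual.F1Sign2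

end
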